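import Summits.BirchSwinnertonDyer.BirchSwinnertonDyer.Theorems.GoldfeldAllTwistsTwoConverseTwinGenusRankOneNegTwo
import Summits.BirchSwinnertonDyer.BirchSwinnertonDyer.Theorems.GoldfeldAllTwistsTwoConverseTwinGenusPartnerNegPrime
import Summits.BirchSwinnertonDyer.BirchSwinnertonDyer.Theorems.GoldfeldAllTwistsTwoConverseTwinGenusDescentRankZero
import Summits.BirchSwinnertonDyer.BirchSwinnertonDyer.Theorems.GoldfeldAllTwistsTwoConverseTwinGenusDescentIndex
import HarnessLib

set_option linter.dupNamespace false -- namespace `…BirchSwinnertonDyer.BirchSwinnertonDyer…` is the cell's (D-0017 nested layout)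
set_option autoImplicit false

/-!
# LINE B49, family F3 (`d_K = −8ℓ`): (RO″) — the `χ`-part of `X₀(49)` over the Hilbert class field of `ℚ(√−2ℓ)` has
# rank at most one (collinearity of the genus point `P_χ` with the partner point, modulo torsion)

Cell `bsd-goldfeld`, seat `bsd-goldfeld-s1p-c3x` (prover, gen 0; second lane on item `stmt-BirchSwinnertonDyer-19350`, instruction
of record `HOME/LANE-BRIEF-S1P-C3X.md` §2 file 2, collinearity half), `--supports stmt-BirchSwinnertonDyer-19350`. Theses-free;
theorems only. HONEST FRAMING: BSD is not proved by any of this; the one printed input is Coates–Li–Tian–Zhai 2015 Thm. 1.4 at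
`(l₀, R₁, N) = (ℓ, 1, 1)` («`rank 49a1^{(−ℓ)}(ℚ) = 1`»), BY NAME as the binder `(h14 : thm14_rankOne_twist)` through seat c3 gen 11's
`rankOne_negPrimeTwist_of_thm14'`; everything else is descent algebra in the kernel (step (4), collinearity half, of THEOREM A″;
scoping memo `HOME/GENUS-THEOREM-A-DOUBLEPRIME-SCOPING.md` §2).

SETTING: `ℓ > 3` prime, `ℓ ≡ 3 (mod 4)`, `(ℓ/7) = −1`; `K` imaginary quadratic, `d_K = −8ℓ`; `L/K` finite Galois (`L = K[1]` in the
application); `r₀ ∈ L`, `r₀² = −ℓ` (`K(r₀) = ℚ(√2, √−ℓ) = J`, the genus field). A `χ`-POINT of `X₀(49)(L)`: fixed by every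
`σ ∈ Gal(L/K)` with `σ r₀ = r₀`, negated by every `σ` with `σ r₀ = −r₀` (e.g. `P_χ = Σ_σ χ(σ)•σ y₁`, `isChiPoint_twistedSum`; and
`2Y_ℓ − T` for the partner Heegner point, by Birch's relation — assembly file). MAIN THEOREM
`exists_zsmul_sub_zsmul_isOfFinAddOrder_of_isChiPoint_negEightPrime` (§4): two `χ`-points `Z₁, Z₂` with `Z₂` of infinite order
satisfy `a•Z₁ − b•Z₂ ∈ tors` with `a ≠ 0`. PROOF (seat c3's F2 template `exists_oddIndex_twistedSum_negEight`, `θ₀ = r₀`, no fixed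
point): §2 a `χ`-point descends to `X₀(49)(J)`, `J = K⟮r₀⟯` (`[J:K] = 2`, §1), ANTI-invariant under `Gal(J/K)`; so on the
completed-square model it is `τ(R)` for a `K`-point `R` of `(X₀(49) ⊗ K)^{(−ℓ)} = (49a1^{(−ℓ)})^{(1)} ⊗ K` (tree `QuadraticDescent`);
§3 for `K`-points of `V₁ = (49a1^{(−ℓ)})^{(1)}`: `2R = (R + σR) + (R − σR)` with `R + σR ∈ V₁(ℚ) = ℤ•g + tors` (rank ONE, `h14`) and
`R − σR` the twist of a `ℚ`-point of `V₁^{(d_K)} = 49a1^{(8ℓ²)} ≅ 49a1^{(2)}`, all torsion (rank ZERO, seat c3's fact-free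
`rank_eq_zero_and_sha_two_cm7_quadraticTwist_two`), so `2R ≡ m•g`; §4 `m₂•(2R₁) ≡ m₁•(2R₂)`, `m₂ ≠ 0`, pushed back to `L`.

References: [CoatesLiTianZhai2015] Thm 1.4, (2.8); [SilvermanAEC2009] X.2 Prop. 2.4, X.5 Cor. 5.4, Ex. 10.16, VIII.6.7; [Gross1984] §§4–5. -/

noncomputable section

open scoped Classical IntermediateField

open WeierstrassCurve Literature.NumberTheory.EllipticCurves
  Literature.NumberTheory.EllipticCurves.ModularForms Literature.NumberTheory.EllipticCurves.CoatesLiTianZhai2015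

namespace Summit.BirchSwinnertonDyer.BirchSwinnertonDyer.Theorems.GoldfeldGoodTwists

section Arith

variable {K : Type} [Field K] [NumberField K]

/-- `−ℓ` is not a square in `K` when `d_K = −8ℓ`, `ℓ` prime: else `−ℓ < 0` or `(−ℓ)·d_K = 8ℓ² = 2·(2ℓ)²` would be a
rational square. [folklore] -/
theorem not_isSquare_neg_natCast_of_discr_eq_negEightPrime (hK : IsImaginaryQuadratic K) {l : ℕ} (hl : l.Prime)
    (hdK : NumberField.discr K = -(8 * (l : ℤ))) : ¬ IsSquare (-(l : K)) := by
  intro h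
  have h' : IsSquare (algebraMap ℚ K (-(l : ℚ))) := by rwa [map_neg, map_natCast]
  have hl0 : (0 : ℚ) < l := by exact_mod_cast hl.pos
  rcases isSquare_or_of_isSquare_algebraMap_rat hK h' with h1 | h1
  · exact not_isSquare_of_neg (by linarith) h1
  · rw [hdK] at h1
    push_cast at h1
    have h2 : IsSquare (2 : ℚ) := by
      obtain ⟨r, hr⟩ := h1
      have h8 : r * r = 8 * (l : ℚ) ^ 2 := by linear_combination -hr
      have hne : (2 * (l : ℚ)) * (2 * (l : ℚ)) ≠ 0 := by positivity
      refine ⟨r / (2 * l), ?_⟩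
      rw [div_mul_div_comm, eq_div_iff hne, h8]
      ring
    exact not_isSquare_prime Nat.prime_two (Rat.isSquare_natCast_iff.mp (by exact_mod_cast h2))

end Arith

section GenusField

variable {K : Type} [Field K] [NumberField K] {L : Type*} [Field L] [CharZero L] [Algebra K L]
  [FiniteDimensional K L] [IsGalois K L]

omit [CharZero L] [IsGalois K L] in
/-- `[K⟮r₀⟯ : K] = 2` for `r₀² = −ℓ`, `d_K = −8ℓ`. [folklore] -/
theorem finrank_genusField_negEightPrime (hK : IsImaginaryQuadratic K) {l : ℕ} (hl : l.Prime)
    (hdK : NumberField.discr K = -(8 * (l : ℤ))) {r₀ : L} (hr : r₀ ^ 2 = algebraMap K L (-(l : K))) :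
    Module.finrank K K⟮r₀⟯ = 2 :=
  finrank_adjoin_sqrt_eq_two (L := L) hr (not_isSquare_neg_natCast_of_discr_eq_negEightPrime hK hl hdK)

omit [CharZero L] [FiniteDimensional K L] [IsGalois K L] in
/-- `r₀ ∉ K` (inside `K⟮r₀⟯`). [folklore] -/
theorem gen_not_mem_range_negEightPrime (hK : IsImaginaryQuadratic K) {l : ℕ} (hl : l.Prime)
    (hdK : NumberField.discr K = -(8 * (l : ℤ))) {r₀ : L} (hr : r₀ ^ 2 = algebraMap K L (-(l : K))) :
    ((⟨r₀, IntermediateField.mem_adjoin_simple_self K r₀⟩ : K⟮r₀⟯) : K⟮r₀⟯) ∉ Set.range (algebraMap K K⟮r₀⟯) := by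
  rintro ⟨κ, hκ⟩
  have hκL : algebraMap K L κ = r₀ := by
    have := congrArg Subtype.val hκ
    simpa using this
  exact algebraMap_ne_sqrt_of_not_isSquare hr (not_isSquare_neg_natCast_of_discr_eq_negEightPrime hK hl hdK) κ hκL

omit [FiniteDimensional K L] [IsGalois K L] in
/-- `r₀² = −ℓ` inside `K⟮r₀⟯`. [folklore] -/
theorem gen_sq_negEightPrime {l : ℕ} {r₀ : L} (hr : r₀ ^ 2 = algebraMap K L (-(l : K))) :
    (⟨r₀, IntermediateField.mem_adjoin_simple_self K r₀⟩ : K⟮r₀⟯) ^ 2 = algebraMap K K⟮r₀⟯ (-(l : K)) := by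
  apply Subtype.ext
  simp only [map_neg, map_natCast]
  push_cast
  rw [hr, map_neg, map_natCast]

/-- **Descent of a `χ`-point to the genus field, with anti-invariance**: a `χ`-point `Z ∈ X₀(49)(L)` is the image of a
point `z ∈ X₀(49)(K⟮r₀⟯)` NEGATED by the non-trivial `K`-automorphism of `K⟮r₀⟯` (`Quadratic.conj`, `r₀ ↦ −r₀`; its lift
`τ ∈ Gal(L/K)` has `τ r₀ = −r₀`, so `τZ = −Z`). [cite: Gross1984, §§4–5] [cite: CoatesLiTianZhai2015, (2.8)] -/
theorem exists_descent_of_isChiPoint_negEightPrime {l : ℕ} {r₀ : L}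
    (hfin : Module.finrank K K⟮r₀⟯ = 2)
    (hθ : ((⟨r₀, IntermediateField.mem_adjoin_simple_self K r₀⟩ : K⟮r₀⟯) : K⟮r₀⟯) ∉ Set.range (algebraMap K K⟮r₀⟯))
    (hi : (⟨r₀, IntermediateField.mem_adjoin_simple_self K r₀⟩ : K⟮r₀⟯) ^ 2 = algebraMap K K⟮r₀⟯ (-(l : K)))
    (Z : (cm7.baseChange L).toAffine.Point)
    (hZfix : ∀ σ : L ≃ₐ[K] L, σ r₀ = r₀ → Affine.Point.map (σ : L →ₐ[K] L) Z = Z)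
    (hZneg : ∀ σ : L ≃ₐ[K] L, σ r₀ = -r₀ → Affine.Point.map (σ : L →ₐ[K] L) Z = -Z) :
    ∃ z : (cm7.baseChange K⟮r₀⟯).toAffine.Point,
      Affine.Point.map (algebraMap K⟮r₀⟯ L).toRatAlgHom z = Z ∧
      Affine.Point.map (W' := cm7) (Literature.NumberTheory.QuadraticFields.Quadratic.conj hfin hθ hi) z = -z := by
  obtain ⟨z, hz⟩ := exists_map_adjoin_eq_of_forall_fixing cm7 r₀ hZfix
  -- the conjugation of `K⟮r₀⟯/K` and its lift to `Gal(L/K)`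
  haveI : Normal K L := inferInstance
  obtain ⟨τ, hτ⟩ : ∃ τ : L ≃ₐ[K] L, τ = AlgEquiv.ofBijective
      ((Literature.NumberTheory.QuadraticFields.Quadratic.conj hfin hθ hi).liftNormal L)
      (AlgHom.normal_bijective K L L _) := ⟨_, rfl⟩
  have hτcomm : ∀ x : K⟮r₀⟯, τ (algebraMap K⟮r₀⟯ L x) =
      algebraMap K⟮r₀⟯ L (Literature.NumberTheory.QuadraticFields.Quadratic.conj hfin hθ hi x) := fun x ↦ by
    rw [hτ]; exact (Literature.NumberTheory.QuadraticFields.Quadratic.conj hfin hθ hi).liftNormal_commutes L x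
  have hτr : τ r₀ = -r₀ := by
    have h1 := hτcomm ⟨r₀, IntermediateField.mem_adjoin_simple_self K r₀⟩
    rw [Literature.NumberTheory.QuadraticFields.Quadratic.conj_gen, map_neg] at h1
    simpa using h1
  refine ⟨z, hz, ?_⟩
  apply Affine.Point.map_injective (W' := cm7) (f := (algebraMap K⟮r₀⟯ L).toRatAlgHom)
  have step1 : ∀ P : (cm7.baseChange K⟮r₀⟯).toAffine.Point,
      Affine.Point.map (algebraMap K⟮r₀⟯ L).toRatAlgHom
        (Affine.Point.map (W' := cm7) (Literature.NumberTheory.QuadraticFields.Quadratic.conj hfin hθ hi) P) =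
      Affine.Point.map (τ : L →ₐ[K] L) (Affine.Point.map (algebraMap K⟮r₀⟯ L).toRatAlgHom P) := by
    intro P
    rcases P with _ | ⟨x, y, hxy⟩
    · rfl
    · simp only [Affine.Point.map_some, Affine.Point.some.injEq]
      exact ⟨by simpa using (hτcomm x).symm, by simpa using (hτcomm y).symm⟩
  rw [step1, map_neg, hz, hZneg τ hτr]

end GenusField

-- From here on, one decidability world for all point groups (ℚ, K, K⟮r₀⟯, L): the classical one at top priority, as in
-- the F1/F2 templates `…TwinGenusRankOne{,NegTwo}` whose `QuadraticDescent` lemmas are consumed verbatim (§§1–2 above are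
-- elaborated in the default world, like `…TwinGenusFieldDescent` / `…RankOneDescentNegTwo`, and re-read below by `rfl`).
attribute [local instance 2000] Classical.propDecidable

section RatStepNegEightPrime

/-- The completed-square copy of `cm7^{(−ℓ)}` is `cm7^{(−ℓ)}` itself (`a₁ = a₃ = 0`). [cite: SilvermanAEC2009, III.1] -/
theorem quadraticTwist_negPrime_quadraticTwist_one (l : ℕ) :
    (cm7.quadraticTwist (-(l : ℚ))).quadraticTwist 1 = cm7.quadraticTwist (-(l : ℚ)) := by
  ext <;> simp [quadraticTwist, b₂, b₄, b₆]

/-- `(cm7^{(−ℓ)})^{(−8ℓ)} = cm7^{(2·(2ℓ)²)}` (iterated twists multiply). [cite: SilvermanAEC2009, X.2 Prop. 2.4] -/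
theorem quadraticTwist_negPrime_quadraticTwist_negEight (l : ℕ) :
    (cm7.quadraticTwist (-(l : ℚ))).quadraticTwist (-(8 * (l : ℚ))) = cm7.quadraticTwist (2 * (2 * (l : ℚ)) ^ 2) := by
  ext <;> simp [quadraticTwist, b₂, b₄, b₆] <;> ring

/-- **Every `ℚ`-point of `(49a1^{(−ℓ)})^{(−8ℓ)} = 49a1^{(8ℓ²)} ≅ 49a1^{(2)}` is torsion** (`ℓ ≠ 0`): rank `0` of `cm7^{(2)}` by
seat c3's fact-free `2`-isogeny descent `rank_eq_zero_and_sha_two_cm7_quadraticTwist_two`. [cite: SilvermanAEC2009, X.4.2(a), X.5 Cor. 5.4] -/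
theorem isOfFinAddOrder_point_twist_negPrime_negEight {l : ℕ} (hl : l ≠ 0)
    (P : ((cm7.quadraticTwist (-(l : ℚ))).quadraticTwist (-(8 * (l : ℚ)))).toAffine.Point) : IsOfFinAddOrder P := by
  haveI := isElliptic_cm7_quadraticTwist_two
  haveI : Finite (cm7.quadraticTwist 2).toAffine.Point :=
    (cm7.quadraticTwist 2).mordellWeilRank_eq_zero_iff_finite.mp rank_eq_zero_and_sha_two_cm7_quadraticTwist_two.1
  have h2l : (2 * (l : ℚ)) ≠ 0 := mul_ne_zero two_ne_zero (by exact_mod_cast hl)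
  obtain ⟨C, hC⟩ := cm7.exists_variableChange_quadraticTwist_mul_sq 2 (2 * (l : ℚ)) h2l
  let e : ((cm7.quadraticTwist (-(l : ℚ))).quadraticTwist (-(8 * (l : ℚ)))).toAffine.Point ≃+
      (cm7.quadraticTwist 2).toAffine.Point :=
    ((Affine.Point.congrEquiv (quadraticTwist_negPrime_quadraticTwist_negEight l)).trans
      (Affine.Point.congrEquiv hC.symm)).trans (VariableChange.pointEquiv (cm7.quadraticTwist 2) C).symm
  simpa using e.symm.toAddMonoidHom.isOfFinAddOrder (isOfFinAddOrder_of_finite (e P))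

/-- `V₁ = (cm7^{(−ℓ)})^{(1)}` is elliptic. [folklore] -/
theorem isElliptic_twist_negPrime_one {l : ℕ} (hl : l ≠ 0) :
    ((cm7.quadraticTwist (-(l : ℚ))).quadraticTwist 1).IsElliptic := by
  rw [quadraticTwist_negPrime_quadraticTwist_one]
  exact cm7.isElliptic_quadraticTwist (neg_ne_zero.mpr (by exact_mod_cast hl))

/-- **`rank V₁(ℚ) = 1` BY NAME** (`V₁ = (cm7^{(−ℓ)})^{(1)} = cm7^{(−ℓ)}`, a model of `49a1^{(−ℓ)}`), `ℓ > 3` prime, `ℓ ≡ 3 (mod 4)`,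
`(ℓ/7) = −1`: Coates–Li–Tian–Zhai 2015 Thm. 1.4 on a globally minimal model (seat c3 gen 11's `rankOne_negPrimeTwist_of_thm14'`),
transported by `mordellWeilRank_variableChange_holds`. [cite: CoatesLiTianZhai2015, Thm. 1.4 (p. 360), case k = r = 0] -/
theorem mordellWeilRank_twist_negPrime_one (h14 : thm14_rankOne_twist) {l : ℕ} (hl : l.Prime) (h3 : 3 < l)
    (hl4 : l % 4 = 3) (hl7 : jacobiSym l 7 = -1) :
    (haveI := isElliptic_twist_negPrime_one hl.ne_zero;
      ((cm7.quadraticTwist (-(l : ℚ))).quadraticTwist 1).mordellWeilRank) = 1 := by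
  have hd : (-(l : ℚ)) ≠ 0 := neg_ne_zero.mpr (by exact_mod_cast hl.ne_zero)
  haveI := cm7.isElliptic_quadraticTwist hd
  haveI := isElliptic_twist_negPrime_one hl.ne_zero
  obtain ⟨W', hE', hmin', C, hC⟩ := exists_isGloballyMinimal_smul_eq_quadraticTwist cm7 hd
  have h1 : W'.mordellWeilRank = 1 := (rankOne_negPrimeTwist_of_thm14' h14 hl h3 hl4 hl7 W' ⟨C, hC⟩).2.1
  have h2 : (cm7.quadraticTwist (-(l : ℚ))).mordellWeilRank = 1 := by
    have h := mordellWeilRank_variableChange_holds W' C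
    unfold mordellWeilRank_variableChange at h
    rw [← hC, h, h1]
  rw [mordellWeilRank_congr (quadraticTwist_negPrime_quadraticTwist_one l), h2]

variable {K : Type} [Field K] [NumberField K]

/-- **The `K/ℚ` step (family F3)**: `V₁ = (cm7^{(−ℓ)})^{(1)}`, `d_K = −8ℓ`; granted CLTZ15 Thm. 1.4 by name (`h14`) there is
`g ∈ V₁(ℚ)` with `2P − m • ι(g) ∈ tors` for EVERY `P ∈ V₁(K)` and some `m` (`2P = (P + σP) + (P − σP)`: the first summand is
`≡ m•g` along a rank-one Mordell–Weil basis, the second is a twist of a `ℚ`-point of `V₁^{(d_K)} = 49a1^{(8ℓ²)}`, torsion).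
[cite: CoatesLiTianZhai2015, Thm. 1.4 (p. 360)] [cite: SilvermanAEC2009, X.2 Prop. 2.4, Exercise 10.16 and Thm. VIII.6.7] -/
theorem exists_two_zsmul_sub_incl_negEightPrime (h14 : thm14_rankOne_twist) (hK : IsImaginaryQuadratic K)
    {l : ℕ} (hl : l.Prime) (h3 : 3 < l) (hl4 : l % 4 = 3) (hl7 : jacobiSym l 7 = -1)
    (hdK : NumberField.discr K = -(8 * (l : ℤ))) :
    ∃ g : ((cm7.quadraticTwist (-(l : ℚ))).quadraticTwist 1).toAffine.Point,
      ∀ P : (((cm7.quadraticTwist (-(l : ℚ))).quadraticTwist 1).baseChange K).toAffine.Point,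
        ∃ m : ℤ, IsOfFinAddOrder ((2 : ℤ) • P -
          m • QuadraticDescent.incl K ((cm7.quadraticTwist (-(l : ℚ))).quadraticTwist 1) g) := by
  haveI := isElliptic_twist_negPrime_one (l := l) hl.ne_zero
  obtain ⟨B, hB⟩ := exists_isMordellWeilBasis_fin_one _ (mordellWeilRank_twist_negPrime_one h14 hl h3 hl4 hl7)
  refine ⟨B 0, fun P => ?_⟩
  obtain ⟨δ, hδ, hδK, -⟩ := exists_sq_eq_discr_and_span hK
  have hθ : δ ∉ Set.range (algebraMap ℚ K) := by rintro ⟨a, ha⟩; exact hδK a ha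
  have hσσ : ∀ z, Literature.NumberTheory.QuadraticFields.Quadratic.conj hK.1 hθ hδ
      (Literature.NumberTheory.QuadraticFields.Quadratic.conj hK.1 hθ hδ z) = z :=
    Literature.NumberTheory.QuadraticFields.Quadratic.conj_conj hK.1 hθ hδ
  -- the `σ`-fixed part comes from `V₁(ℚ)`
  obtain ⟨Q, hQ⟩ : ∃ Q : ((cm7.quadraticTwist (-(l : ℚ))).quadraticTwist 1).toAffine.Point,
      QuadraticDescent.incl K ((cm7.quadraticTwist (-(l : ℚ))).quadraticTwist 1) Q =
      P + QuadraticDescent.conjMap ((cm7.quadraticTwist (-(l : ℚ))).quadraticTwist 1)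
        (Literature.NumberTheory.QuadraticFields.Quadratic.conj hK.1 hθ hδ) P :=
    exists_incl_eq_of_conjMap_eq ((cm7.quadraticTwist (-(l : ℚ))).quadraticTwist 1) hK.1 hθ hδ (by
      rw [map_add, QuadraticDescent.conjMap_conjMap ((cm7.quadraticTwist (-(l : ℚ))).quadraticTwist 1) hσσ, add_comm])
  -- the `σ`-anti-fixed part comes from the twist by `d_K`, all of whose `ℚ`-points are torsion
  obtain ⟨R, hR⟩ : ∃ R : ((cm7.quadraticTwist (-(l : ℚ))).quadraticTwist (NumberField.discr K : ℚ)).toAffine.Point,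
      QuadraticDescent.twistMap (cm7.quadraticTwist (-(l : ℚ))) hθ hδ R =
        P - QuadraticDescent.conjMap ((cm7.quadraticTwist (-(l : ℚ))).quadraticTwist 1)
          (Literature.NumberTheory.QuadraticFields.Quadratic.conj hK.1 hθ hδ) P :=
    exists_twistMap_eq_of_conjMap_eq_neg (cm7.quadraticTwist (-(l : ℚ))) hK.1 hθ hδ (by
      rw [map_sub, QuadraticDescent.conjMap_conjMap ((cm7.quadraticTwist (-(l : ℚ))).quadraticTwist 1) hσσ, neg_sub])
  have hRt : IsOfFinAddOrder R := by
    have hc : (NumberField.discr K : ℚ) = -(8 * (l : ℚ)) := by rw [hdK]; push_cast; ring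
    have e := Affine.Point.congrEquiv (congrArg (cm7.quadraticTwist (-(l : ℚ))).quadraticTwist hc)
    have h := isOfFinAddOrder_point_twist_negPrime_negEight hl.ne_zero (e R)
    simpa using e.symm.toAddMonoidHom.isOfFinAddOrder h
  -- `Q ≡ m • g` along the basis
  obtain ⟨m, hm⟩ := exists_sub_zsmul_isOfFinAddOrder_of_isMordellWeilBasis hB Q
  refine ⟨m, ?_⟩
  have e2 : (P + QuadraticDescent.conjMap ((cm7.quadraticTwist (-(l : ℚ))).quadraticTwist 1)
        (Literature.NumberTheory.QuadraticFields.Quadratic.conj hK.1 hθ hδ) P) +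
      (P - QuadraticDescent.conjMap ((cm7.quadraticTwist (-(l : ℚ))).quadraticTwist 1)
        (Literature.NumberTheory.QuadraticFields.Quadratic.conj hK.1 hθ hδ) P) = (2 : ℤ) • P := by
    abel
  have hdec : (2 : ℤ) • P - m • QuadraticDescent.incl K ((cm7.quadraticTwist (-(l : ℚ))).quadraticTwist 1) (B 0) =
      QuadraticDescent.incl K ((cm7.quadraticTwist (-(l : ℚ))).quadraticTwist 1) (Q - m • B 0) +
        QuadraticDescent.twistMap (cm7.quadraticTwist (-(l : ℚ))) hθ hδ R := by
    rw [← e2, ← hQ, hR, map_sub, map_zsmul]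
    abel
  rw [hdec]
  exact isOfFinAddOrder_add'
    ((QuadraticDescent.incl K ((cm7.quadraticTwist (-(l : ℚ))).quadraticTwist 1)).isOfFinAddOrder hm)
    ((QuadraticDescent.twistMap _ hθ hδ).isOfFinAddOrder hRt)

end RatStepNegEightPrime

section ChiPartRankOne

variable {K : Type} [Field K] [NumberField K] {L : Type*} [Field L] [CharZero L] [Algebra K L]
  [FiniteDimensional K L] [IsGalois K L]

/-- `(cm7 ⊗ K)^{(−ℓ)} = ((cm7^{(−ℓ)})^{(1)}) ⊗ K` — the partner curve `49a1^{(−ℓ)}` read over `K`. [cite: SilvermanAEC2009, X.2 Prop. 2.4] -/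
theorem cm7_baseChange_quadraticTwist_negPrime (K : Type) [Field K] [NumberField K] (l : ℕ) :
    (cm7.baseChange K).quadraticTwist (-(l : K)) = ((cm7.quadraticTwist (-(l : ℚ))).quadraticTwist 1).baseChange K := by
  rw [quadraticTwist_negPrime_quadraticTwist_one, baseChange, baseChange, map_quadraticTwist, map_neg, map_natCast]

/-- Torsion is closed under subtraction (local helper). [folklore] -/
private theorem tors_sub {A : Type*} [AddCommGroup A] {a b : A} (ha : IsOfFinAddOrder a) (hb : IsOfFinAddOrder b) :
    IsOfFinAddOrder (a - b) := by rw [← AddCommGroup.mem_torsion] at ha hb ⊢; exact sub_mem ha hb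

/-- If `2 • u` has finite order then so has `u` (local helper). [folklore] -/
private theorem tors_of_two_zsmul {A : Type*} [AddCommGroup A] {u : A} (h : IsOfFinAddOrder ((2 : ℤ) • u)) :
    IsOfFinAddOrder u := by
  obtain ⟨n, hn, hnu⟩ := (isOfFinAddOrder_iff_zsmul_eq_zero).mp h
  exact (isOfFinAddOrder_iff_zsmul_eq_zero).mpr ⟨n * 2, mul_ne_zero hn two_ne_zero, by rw [mul_smul, hnu]⟩

/-- **(RO″) — THE `χ`-PART OF `X₀(49)(L)` HAS RANK AT MOST ONE (family F3)**: `ℓ > 3` prime, `ℓ ≡ 3 (mod 4)`, `(ℓ/7) = −1`,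
`d_K = −8ℓ`, `L/K` finite Galois, `r₀² = −ℓ`; granted CLTZ15 Thm. 1.4 by name (`h14`), two `χ`-points `Z₁, Z₂ ∈ X₀(49)(L)` with
`Z₂` of infinite order have `a•Z₁ − b•Z₂ ∈ tors` for some `a ≠ 0`, `b` (application: `Z₁ = P_χ`, `Z₂ = 2Y_ℓ − T`).
[cite: CoatesLiTianZhai2015, Thm. 1.4 (p. 360) and (2.8)] [cite: SilvermanAEC2009, X.2 Prop. 2.4, Exercise 10.16] [cite: Gross1984, §§4–5] -/
theorem exists_zsmul_sub_zsmul_isOfFinAddOrder_of_isChiPoint_negEightPrime (h14 : thm14_rankOne_twist)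
    (hK : IsImaginaryQuadratic K) {l : ℕ} (hl : l.Prime) (h3 : 3 < l) (hl4 : l % 4 = 3) (hl7 : jacobiSym l 7 = -1)
    (hdK : NumberField.discr K = -(8 * (l : ℤ))) {r₀ : L} (hr : r₀ ^ 2 = algebraMap K L (-(l : K)))
    (Z₁ Z₂ : (cm7.baseChange L).toAffine.Point)
    (h₁fix : ∀ σ : L ≃ₐ[K] L, σ r₀ = r₀ → Affine.Point.map (σ : L →ₐ[K] L) Z₁ = Z₁)
    (h₁neg : ∀ σ : L ≃ₐ[K] L, σ r₀ = -r₀ → Affine.Point.map (σ : L →ₐ[K] L) Z₁ = -Z₁)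
    (h₂fix : ∀ σ : L ≃ₐ[K] L, σ r₀ = r₀ → Affine.Point.map (σ : L →ₐ[K] L) Z₂ = Z₂)
    (h₂neg : ∀ σ : L ≃ₐ[K] L, σ r₀ = -r₀ → Affine.Point.map (σ : L →ₐ[K] L) Z₂ = -Z₂)
    (hZ₂ : ¬ IsOfFinAddOrder Z₂) :
    ∃ a b : ℤ, a ≠ 0 ∧ IsOfFinAddOrder (a • Z₁ - b • Z₂) := by
  have hfin := finrank_genusField_negEightPrime hK hl hdK hr
  have hθ := gen_not_mem_range_negEightPrime hK hl hdK hr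
  have hi := gen_sq_negEightPrime (K := K) hr
  obtain ⟨z₁, hz₁, hanti₁⟩ := exists_descent_of_isChiPoint_negEightPrime hfin hθ hi Z₁ h₁fix h₁neg
  obtain ⟨z₂, hz₂, hanti₂⟩ := exists_descent_of_isChiPoint_negEightPrime hfin hθ hi Z₂ h₂fix h₂neg
  -- re-read the default-world statements in this file's instance world
  have hz₁' : Affine.Point.map (W' := cm7) (algebraMap K⟮r₀⟯ L).toRatAlgHom z₁ = Z₁ := by
    rw [← hz₁]; rcases z₁ with _ | ⟨x, y, hxy⟩ <;> rfl
  have hz₂' : Affine.Point.map (W' := cm7) (algebraMap K⟮r₀⟯ L).toRatAlgHom z₂ = Z₂ := by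
    rw [← hz₂]; rcases z₂ with _ | ⟨x, y, hxy⟩ <;> rfl
  have hanti₁' : Affine.Point.map (W' := cm7)
      (Literature.NumberTheory.QuadraticFields.Quadratic.conj hfin hθ hi) z₁ = -z₁ := by
    rcases z₁ with _ | ⟨x, y, hxy⟩ <;> [rfl; exact hanti₁]
  have hanti₂' : Affine.Point.map (W' := cm7)
      (Literature.NumberTheory.QuadraticFields.Quadratic.conj hfin hθ hi) z₂ = -z₂ := by
    rcases z₂ with _ | ⟨x, y, hxy⟩ <;> [rfl; exact hanti₂]
  -- the completing-square transport `e : X₀(49)(K⟮r₀⟯) ≃ (cm7 ⊗ K)^{(1)}(K⟮r₀⟯)`, natural in `Gal(K⟮r₀⟯/K)` (F2 template)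
  have hbb : (cm7.baseChange K).baseChange K⟮r₀⟯ = cm7.baseChange K⟮r₀⟯ :=
    cm7.map_baseChange (IsScalarTower.toAlgHom ℚ K K⟮r₀⟯)
  have hC := completeSquare_smul_cm7_baseChange K
  let e₀ : (cm7.baseChange K⟮r₀⟯).toAffine.Point ≃+ ((cm7.baseChange K).baseChange K⟮r₀⟯).toAffine.Point :=
    Affine.Point.congrEquiv hbb.symm
  let e₁ := VariableChange.pointEquivBaseChange (cm7.baseChange K)
    (((⟨1, 0, -(1 / 2 : ℚ), 0⟩ : VariableChange ℚ).map (algebraMap ℚ K))) K⟮r₀⟯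
  let e₂ := Affine.Point.congrEquiv (congrArg (fun X : WeierstrassCurve K => X.baseChange K⟮r₀⟯) hC)
  let e := e₀.trans (e₁.trans e₂)
  have hσ : ∀ P : (cm7.baseChange K⟮r₀⟯).toAffine.Point,
      Affine.Point.map (W' := (cm7.baseChange K).quadraticTwist 1)
          (Literature.NumberTheory.QuadraticFields.Quadratic.conj hfin hθ hi) (e P) =
        e (Affine.Point.map (W' := cm7) (Literature.NumberTheory.QuadraticFields.Quadratic.conj hfin hθ hi) P) := by
    intro P
    have h0 : ∀ Q : (cm7.baseChange K⟮r₀⟯).toAffine.Point,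
        Affine.Point.map (W' := cm7.baseChange K)
            (Literature.NumberTheory.QuadraticFields.Quadratic.conj hfin hθ hi) (e₀ Q) =
          e₀ (Affine.Point.map (W' := cm7) (Literature.NumberTheory.QuadraticFields.Quadratic.conj hfin hθ hi) Q) := by
      intro Q
      rcases Q with _ | ⟨x, y, hxy⟩
      · simp [e₀, Affine.Point.congrEquiv_zero, ← Affine.Point.zero_def]
      · simp only [e₀, Affine.Point.congrEquiv_some, Affine.Point.map_some]
    show Affine.Point.map _ (e₂ (e₁ (e₀ P))) = e₂ (e₁ (e₀ (Affine.Point.map _ P)))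
    rw [← h0, ← VariableChange.pointEquivBaseChange_map]
    exact map_congrEquiv_baseChange hC _ _
  have hanti : ∀ z : (cm7.baseChange K⟮r₀⟯).toAffine.Point,
      Affine.Point.map (W' := cm7) (Literature.NumberTheory.QuadraticFields.Quadratic.conj hfin hθ hi) z = -z →
      QuadraticDescent.conjMap ((cm7.baseChange K).quadraticTwist 1)
        (Literature.NumberTheory.QuadraticFields.Quadratic.conj hfin hθ hi) (e z) = -(e z) := by
    intro z hz
    have h1 := hσ z
    rw [hz, map_neg] at h1
    exact h1
  -- both points are twists of `K`-points of the partner `(cm7 ⊗ K)^{(−ℓ)}`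
  obtain ⟨R₁, hR₁⟩ := exists_twistMap_eq_of_conjMap_eq_neg (cm7.baseChange K) hfin hθ hi (hanti z₁ hanti₁')
  obtain ⟨R₂, hR₂⟩ := exists_twistMap_eq_of_conjMap_eq_neg (cm7.baseChange K) hfin hθ hi (hanti z₂ hanti₂')
  let κ : ((cm7.baseChange K).quadraticTwist (-(l : K))).toAffine.Point ≃+
      ((((cm7.quadraticTwist (-(l : ℚ))).quadraticTwist 1)).baseChange K).toAffine.Point :=
    Affine.Point.congrEquiv (cm7_baseChange_quadraticTwist_negPrime K l)
  -- the `K/ℚ` step (§3)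
  obtain ⟨g, hg⟩ := exists_two_zsmul_sub_incl_negEightPrime h14 hK hl h3 hl4 hl7 hdK
  obtain ⟨m₁, hm₁⟩ := hg (κ R₁)
  obtain ⟨m₂, hm₂⟩ := hg (κ R₂)
  -- `m₂ ≠ 0` since `Z₂` has infinite order
  have hm₂0 : m₂ ≠ 0 := by
    rintro rfl
    apply hZ₂
    rw [zero_smul, sub_zero] at hm₂
    have hR₂t : IsOfFinAddOrder R₂ := by
      have h := κ.symm.toAddMonoidHom.isOfFinAddOrder hm₂
      rw [map_zsmul, AddEquiv.coe_toAddMonoidHom, AddEquiv.symm_apply_apply] at h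
      exact tors_of_two_zsmul h
    have hz₂t : IsOfFinAddOrder z₂ := by
      have h := (QuadraticDescent.twistMap (cm7.baseChange K) hθ hi).isOfFinAddOrder hR₂t
      rw [hR₂] at h
      simpa using e.symm.toAddMonoidHom.isOfFinAddOrder h
    rw [← hz₂']
    exact (Affine.Point.map (W' := cm7) (algebraMap K⟮r₀⟯ L).toRatAlgHom).isOfFinAddOrder hz₂t
  -- the relation `m₂•(2κR₁) − m₁•(2κR₂) ∈ tors`, pushed back to `L`
  refine ⟨2 * m₂, 2 * m₁, mul_ne_zero two_ne_zero hm₂0, ?_⟩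
  have hrel : IsOfFinAddOrder (m₂ • ((2 : ℤ) • κ R₁) - m₁ • ((2 : ℤ) • κ R₂)) := by
    have eq : m₂ • ((2 : ℤ) • κ R₁) - m₁ • ((2 : ℤ) • κ R₂) =
        m₂ • ((2 : ℤ) • κ R₁ - m₁ • QuadraticDescent.incl K _ g) -
          m₁ • ((2 : ℤ) • κ R₂ - m₂ • QuadraticDescent.incl K _ g) := by
      rw [smul_sub, smul_sub, smul_smul m₂ m₁, smul_smul m₁ m₂, mul_comm m₁ m₂]
      abel
    rw [eq]
    exact tors_sub (isOfFinAddOrder_zsmul m₂ hm₁) (isOfFinAddOrder_zsmul m₁ hm₂)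
  have h1 : IsOfFinAddOrder (m₂ • ((2 : ℤ) • R₁) - m₁ • ((2 : ℤ) • R₂)) := by
    have h := κ.symm.toAddMonoidHom.isOfFinAddOrder hrel
    simpa using h
  have h2 : IsOfFinAddOrder (m₂ • ((2 : ℤ) • e z₁) - m₁ • ((2 : ℤ) • e z₂)) := by
    have h := (QuadraticDescent.twistMap (cm7.baseChange K) hθ hi).isOfFinAddOrder h1
    rw [map_sub, map_zsmul, map_zsmul, map_zsmul, map_zsmul, hR₁, hR₂] at h
    exact h
  have h3' : IsOfFinAddOrder (m₂ • ((2 : ℤ) • z₁) - m₁ • ((2 : ℤ) • z₂)) := by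
    have h := e.symm.toAddMonoidHom.isOfFinAddOrder h2
    simpa using h
  have h4 := (Affine.Point.map (W' := cm7) (algebraMap K⟮r₀⟯ L).toRatAlgHom).isOfFinAddOrder h3'
  rw [map_sub, map_zsmul, map_zsmul, map_zsmul, map_zsmul, hz₁', hz₂'] at h4
  rw [mul_comm (2 : ℤ) m₂, mul_comm (2 : ℤ) m₁, ← smul_smul, ← smul_smul]
  exact h4

end ChiPartRankOne

end Summit.BirchSwinnertonDyer.BirchSwinnertonDyer.Theorems.GoldfeldGoodTwists

end
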